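import Literature.NumberTheory.Transcendental.EulerLehmerConstantsTranscendence
import Literature.NumberTheory.LFunctions.PeriodicDirichletSeriesAtOneDigamma
import HarnessLib

/-!
# Murty–Saradha 2010, Theorem 5 and Corollary 6: `L(1,f)` is transcendental when `Σ f(b) cot(πb/q) ≠ 0`

Topic `Literature/NumberTheory/Transcendental`. Proofs only (no definitions, no named facts).

M. Ram Murty and N. Saradha, *Euler–Lehmer constants and a conjecture of Erdős*, J. Number Theory
130 (2010) 2671–2682 [MurtySaradha2010], with `L(s,f) = Σ_{n≥1} f(n)/n^s` for `f : ℤ/qℤ → ℂ`: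

* «**Theorem 5.** Let `f : ℤ/qℤ → ℚ̄` be an algebraic-valued function not identically zero and `ζ`
  a primitive `q`-th root of unity. Suppose further that `Σ_{a=1}^{q} f(a) = 0`. If
  `f(q)/(2q) + (1/q) Σ_{b=1}^{q−1} f(b)/(1 − ζ^b) ≠ 0`, then the number `Σ_{n=1}^{∞} f(n)/n` is
  transcendental.» — `transcendental_LFunction_one_of_ne_zero` (with the proof's `ζ = e^{2πi/q}`).
* «**Corollary 6.** If `Σ_{b=1}^{q−1} f(b) cot(πb/q) ≠ 0`, then `L(1,f) ≠ 0`.» —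
  `LFunction_one_ne_zero_of_sum_cot_ne_zero`, and in fact `L(1,f)` is then transcendental
  (`transcendental_LFunction_one_of_sum_cot_ne_zero`); series form
  `not_tendsto_sum_div_zero_of_sum_cot_ne_zero`.

Route (the source's §7 goes through `L(1,f) = −Σ f̂(a) log(1 − ζ^a)`; here, equivalently, through
the digamma): Murty–Rath's Theorem 22.3 value `L(1,f) = −(1/q) Σ_{a=1}^{q} f(a) ψ(a/q)` (tree:
`PeriodicLSeries.LFunction_one_eq_neg_sum_mul_digamma`, P1 g55) and Gauss's formula (6)/(7) (tree:
`MurtySaradha2010.digammaReal_add_eulerMascheroni_add_log`) give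
`L(1,f) = (π/2q) Σ_{c<q} f(c) cot(πc/q) − (f(q)/q) log q − (1/q) Σ_{n<q} (Σ_{c<q} f(c) cos(2πnc/q)) log(2 sin(πn/q))`
(`LFunction_one_eq_cot_log`), a linear form in `π` and logarithms of positive algebraic numbers with
algebraic coefficients, to which Lemma 10 (`transcendental_pi_mul_add_sum_log`) applies as soon as
the `π`-coefficient is non-zero; `cot(πb/q) = i − 2i/(1 − ζ^b)` (`§8`) converts the condition into
the printed (11).

Cell pub-zeta5 (HONEST FRAMING: systematic search; no irrationality claim unless certified): a
printed 2010 theorem made a kernel theorem on the tree's proved Baker theorem; nothing here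
concerns `ζ(5)`; Erdős's conjecture itself (Theorem 7 of the source, `q ≡ 3 (mod 4)`) is NOT in
this file.
-/

noncomputable section

open Complex Finset Filter Topology
open Literature.NumberTheory.Automorphic (digammaReal)
open Literature.NumberTheory.Transcendental.KoblitzOgus (isAlgebraic_cos_rat_mul_pi
  isAlgebraic_sin_rat_mul_pi isAlgebraic_I)
open Literature.NumberTheory.LFunctions.PeriodicLSeries (LFunction_one_eq_neg_sum_mul_digamma
  sum_range_apply_add_eq_zero tendsto_sum_range_div)

namespace Literature.NumberTheory.Transcendental

namespace MurtySaradha2010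

variable {N : ℕ} [NeZero N]

/-- `ψ(c/N)` at a real rational point is the real digamma. [folklore] -/
private theorem digamma_natCast_div {c N : ℕ} (hc : 1 ≤ c) (hN : 0 < N) :
    Complex.digamma ((c : ℂ) / N) = ((digammaReal ((c : ℝ) / N) : ℝ) : ℂ) := by
  rw [← Literature.NumberTheory.Automorphic.LegendreP.digamma_ofReal_eq_digammaReal
    (div_pos (by exact_mod_cast hc) (by exact_mod_cast hN))]
  push_cast
  rfl

omit [NeZero N] in
/-- Residues `1, …, N` as `Ico 1 N` and `N`. [folklore] -/
private theorem sum_range_succ_eq (F : ℕ → ℂ) (hN : 1 ≤ N) :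
    ∑ a ∈ range N, F (a + 1) = ∑ c ∈ Ico 1 N, F c + F N := by
  rw [Finset.range_eq_Ico, Finset.sum_Ico_add' F 0 N 1, zero_add, Finset.sum_Ico_succ_top hN]

/-- **`L(1,f)` in Gauss's form.** For `f : ℤ/N → ℂ` with `Σ_j f(j) = 0`:
`L(1,f) = (1/2N)·(Σ_{c=1}^{N−1} f(c) cot(πc/N))·π − (f(0)/N) log N
 − (1/N) Σ_{n=1}^{N−1} (Σ_{c=1}^{N−1} f(c) cos(2πnc/N)) log(2 sin(πn/N))`
(Theorem 22.3's value `−(1/N)Σ_a f(a)ψ(a/N)` with Gauss's digamma theorem at each `a < N` and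
`ψ(1) = −γ`; the `γ`-terms cancel by `Σ f = 0`). [cite: MurtySaradha2010, §7 (proof of Theorem 5) and (6)] -/
theorem LFunction_one_eq_cot_log (Φ : ZMod N → ℂ) (hΦ : ∑ j : ZMod N, Φ j = 0) :
    ZMod.LFunction Φ 1 =
      (2 * (N : ℂ))⁻¹ * (∑ c ∈ Ico 1 N, Φ c * (Real.cot (Real.pi * c / N) : ℂ)) * Real.pi
        - (N : ℂ)⁻¹ * Φ 0 * Real.log N
        - (N : ℂ)⁻¹ * ∑ n ∈ Ico 1 N, (∑ c ∈ Ico 1 N, Φ c * (Real.cos (2 * Real.pi * n * c / N) : ℂ)) *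
            (Real.log (2 * Real.sin (Real.pi * n / N)) : ℂ) := by
  have hN : 0 < N := Nat.pos_of_ne_zero (NeZero.ne N)
  have hNC : (N : ℂ) ≠ 0 := by exact_mod_cast hN.ne'
  -- the zero period-sum, residues `1, …, N`
  have hsum0 : ∑ c ∈ Ico 1 N, Φ c = -Φ 0 := by
    have h := sum_range_apply_add_eq_zero Φ hΦ 1
    have e : ∑ n ∈ range N, Φ ((1 + n : ℕ) : ZMod N) =
        ∑ a ∈ range N, (fun c : ℕ => Φ (c : ZMod N)) (a + 1) :=
      Finset.sum_congr rfl fun n _ => by rw [add_comm]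
    rw [e, sum_range_succ_eq (fun c : ℕ => Φ (c : ZMod N)) hN, ZMod.natCast_self] at h
    linear_combination h
  -- Theorem 22.3's value, residues `1, …, N−1` and `N`
  rw [LFunction_one_eq_neg_sum_mul_digamma Φ hΦ,
    sum_range_succ_eq (fun c : ℕ => Φ (c : ZMod N) * Complex.digamma ((c : ℂ) / N)) hN]
  rw [ZMod.natCast_self, div_self hNC, Complex.digamma_one]
  -- Gauss at each residue `1 ≤ c < N`
  have hG : ∀ c ∈ Ico 1 N, Φ c * Complex.digamma ((c : ℂ) / N) =
      Φ c * (-(Real.eulerMascheroniConstant : ℂ) - Real.log N) +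
      Φ c * (Real.cot (Real.pi * c / N) : ℂ) * (-(1 / 2) * Real.pi) +
      ∑ n ∈ Ico 1 N, Φ c * (Real.cos (2 * Real.pi * n * c / N) : ℂ) *
        (Real.log (2 * Real.sin (Real.pi * n / N)) : ℂ) := by
    intro c hc
    obtain ⟨hc1, hcN⟩ := mem_Ico.1 hc
    rw [digamma_natCast_div hc1 hN]
    have h := digammaReal_add_eulerMascheroni_add_log hc1 hcN
    set S : ℂ := ∑ n ∈ Ico 1 N, (Real.cos (2 * Real.pi * n * c / N) : ℂ) *
      (Real.log (2 * Real.sin (Real.pi * n / N)) : ℂ) with hS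
    have hS' : ∑ n ∈ Ico 1 N, Φ c * (Real.cos (2 * Real.pi * n * c / N) : ℂ) *
        (Real.log (2 * Real.sin (Real.pi * n / N)) : ℂ) = Φ c * S := by
      rw [hS, Finset.mul_sum]
      exact Finset.sum_congr rfl fun n _ => by ring
    have h' : ((digammaReal (c / N) : ℝ) : ℂ) = -(Real.eulerMascheroniConstant : ℂ) - Real.log N +
        (Real.cot (Real.pi * c / N) : ℂ) * (-(1 / 2) * Real.pi) + S := by
      have hc := congrArg (fun x : ℝ => (x : ℂ)) h
      rw [Real.cot_eq_cos_div_sin, hS]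
      push_cast at hc ⊢
      linear_combination hc
    rw [hS', h']
    ring
  rw [Finset.sum_congr rfl hG, Finset.sum_add_distrib, Finset.sum_add_distrib, ← Finset.sum_mul,
    ← Finset.sum_mul, hsum0, Finset.sum_comm]
  have hinner : ∀ n ∈ Ico 1 N, ∑ c ∈ Ico 1 N, Φ c * (Real.cos (2 * Real.pi * n * c / N) : ℂ) *
      (Real.log (2 * Real.sin (Real.pi * n / N)) : ℂ) =
      (∑ c ∈ Ico 1 N, Φ c * (Real.cos (2 * Real.pi * n * c / N) : ℂ)) *
        (Real.log (2 * Real.sin (Real.pi * n / N)) : ℂ) := fun n _ => by rw [Finset.sum_mul]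
  rw [Finset.sum_congr rfl hinner]
  field_simp
  ring

/-! ### Theorem 5 / Corollary 6 in the cotangent form -/

omit [NeZero N] in
/-- `e^{2πib/N} ≠ 1` for `1 ≤ b < N`. [folklore] -/
private theorem exp_ne_one {b : ℕ} (hb : 1 ≤ b) (hbN : b < N) :
    cexp (2 * Real.pi * I * b / N) ≠ 1 := by
  have hN : 0 < N := by omega
  have hNC : (N : ℂ) ≠ 0 := by exact_mod_cast hN.ne'
  intro h
  obtain ⟨n, hn⟩ := Complex.exp_eq_one_iff.1 h
  have hπ : (Real.pi : ℂ) ≠ 0 := by exact_mod_cast Real.pi_ne_zero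
  have h2 : (b : ℂ) = n * N := by
    field_simp at hn
    linear_combination hn
  have h3 : (b : ℤ) = n * N := by
    have h := congrArg Complex.re h2
    simp only [Complex.natCast_re, Complex.mul_re, Complex.intCast_re, Complex.intCast_im,
      Complex.natCast_im, mul_zero, sub_zero] at h
    exact_mod_cast h
  have hb1 : (1 : ℤ) ≤ b := by exact_mod_cast hb
  have hbN' : (b : ℤ) < N := by exact_mod_cast hbN
  have h4 : 0 < n := by
    by_contra hle
    have hle' : n ≤ 0 := not_lt.1 hle
    nlinarith
  nlinarith

/-- **Theorem 5 / Corollary 6 (cotangent form, with transcendence).** For an algebraic-valued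
`f : ℤ/N → ℂ` with `Σ_j f(j) = 0` and `Σ_{c=1}^{N−1} f(c) cot(πc/N) ≠ 0`, the number
`L(1,f) = Σ_{n≥1} f(n)/n` is transcendental (Lemma 10 on `LFunction_one_eq_cot_log`).
[cite: MurtySaradha2010, Theorem 5 and Corollary 6] -/
theorem transcendental_LFunction_one_of_sum_cot_ne_zero (Φ : ZMod N → ℂ)
    (hΦ : ∑ j : ZMod N, Φ j = 0) (halg : ∀ j, IsAlgebraic ℚ (Φ j))
    (hcot : ∑ c ∈ Ico 1 N, Φ c * (Real.cot (Real.pi * c / N) : ℂ) ≠ 0) :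
    Transcendental ℚ (ZMod.LFunction Φ 1) := by
  have hN : 0 < N := Nat.pos_of_ne_zero (NeZero.ne N)
  have hNR : (0 : ℝ) < N := by exact_mod_cast hN
  have hNC : (N : ℂ) ≠ 0 := by exact_mod_cast hN.ne'
  rw [LFunction_one_eq_cot_log Φ hΦ]
  -- the positive algebraic numbers `N, 2 sin(πn/N)` and their algebraic coefficients
  let A : Option (Ico 1 N) → ℝ := fun o => o.elim (N : ℝ) fun n => 2 * Real.sin (Real.pi * n / N)
  let C : Option (Ico 1 N) → ℂ := fun o => o.elim (-((N : ℂ)⁻¹ * Φ 0)) fun n =>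
    -((N : ℂ)⁻¹ * ∑ c ∈ Ico 1 N, Φ c * (Real.cos (2 * Real.pi * (n : ℕ) * c / N) : ℂ))
  have hA : ∀ o, 0 < A o := by
    rintro (_ | ⟨n, hn⟩)
    · exact hNR
    · have h := mem_Ico.1 hn
      have h1 : 0 < Real.pi * n / N := by
        have : (1 : ℝ) ≤ n := by exact_mod_cast h.1
        positivity
      have h2 : Real.pi * n / N < Real.pi := by
        rw [div_lt_iff₀ hNR]
        have : (n : ℝ) < N := by exact_mod_cast h.2
        nlinarith [Real.pi_pos]
      have := Real.sin_pos_of_pos_of_lt_pi h1 h2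
      change 0 < 2 * Real.sin (Real.pi * n / N)
      linarith
  have hAalg : ∀ o, IsAlgebraic ℚ (A o) := by
    rintro (_ | ⟨n, hn⟩)
    · exact isAlgebraic_nat N
    · exact (isAlgebraic_nat 2).mul (isAlgebraic_sin_rat_mul_pi n hN)
  have hmem : ∀ j, Φ j ∈ algebraicClosure ℚ ℂ := fun j => mem_algebraicClosure_iff.2 (halg j)
  have hNmem : (N : ℂ)⁻¹ ∈ algebraicClosure ℚ ℂ := inv_mem (natCast_mem _ N)
  have hCalg : ∀ o, IsAlgebraic ℚ (C o) := by
    rintro (_ | ⟨n, hn⟩)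
    · exact mem_algebraicClosure_iff.1 (neg_mem (mul_mem hNmem (hmem 0)))
    · change IsAlgebraic ℚ (-((N : ℂ)⁻¹ * ∑ c ∈ Ico 1 N, Φ c * (Real.cos (2 * Real.pi * n * c / N) : ℂ)))
      rw [← mem_algebraicClosure_iff]
      refine neg_mem (mul_mem hNmem (sum_mem fun c _ => mul_mem (hmem c) ?_))
      have e : Real.cos (2 * Real.pi * n * c / N) = Real.cos (Real.pi * ((2 * n * c : ℕ) : ℝ) / N) := by
        congr 1
        push_cast
        ring
      rw [mem_algebraicClosure_iff, e]
      exact (isAlgebraic_cos_rat_mul_pi (2 * n * c) hN).algebraMap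
  have hcotalg : ∀ c : ℕ, (Real.cot (Real.pi * c / N) : ℂ) ∈ algebraicClosure ℚ ℂ := by
    intro c
    rw [Real.cot_eq_cos_div_sin, Complex.ofReal_div]
    exact div_mem (mem_algebraicClosure_iff.2 ((isAlgebraic_cos_rat_mul_pi c hN).algebraMap))
      (mem_algebraicClosure_iff.2 ((isAlgebraic_sin_rat_mul_pi c hN).algebraMap))
  have hc₀ : IsAlgebraic ℚ ((2 * (N : ℂ))⁻¹ * ∑ c ∈ Ico 1 N, Φ c * (Real.cot (Real.pi * c / N) : ℂ)) := by
    rw [← mem_algebraicClosure_iff]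
    exact mul_mem (inv_mem (mul_mem (natCast_mem _ 2) (natCast_mem _ N)))
      (sum_mem fun c _ => mul_mem (hmem c) (hcotalg c))
  have hc₀0 : (2 * (N : ℂ))⁻¹ * ∑ c ∈ Ico 1 N, Φ c * (Real.cot (Real.pi * c / N) : ℂ) ≠ 0 :=
    mul_ne_zero (inv_ne_zero (mul_ne_zero two_ne_zero hNC)) hcot
  have e : (2 * (N : ℂ))⁻¹ * (∑ c ∈ Ico 1 N, Φ c * (Real.cot (Real.pi * c / N) : ℂ)) * Real.pi
        - (N : ℂ)⁻¹ * Φ 0 * Real.log N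
        - (N : ℂ)⁻¹ * ∑ n ∈ Ico 1 N, (∑ c ∈ Ico 1 N, Φ c * (Real.cos (2 * Real.pi * n * c / N) : ℂ)) *
            (Real.log (2 * Real.sin (Real.pi * n / N)) : ℂ) =
      (2 * (N : ℂ))⁻¹ * (∑ c ∈ Ico 1 N, Φ c * (Real.cot (Real.pi * c / N) : ℂ)) * Real.pi +
        ∑ o, C o * ((Real.log (A o) : ℝ) : ℂ) := by
    rw [Fintype.sum_option]
    change _ = _ + (-((N : ℂ)⁻¹ * Φ 0) * ((Real.log (N : ℝ) : ℝ) : ℂ) +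
      ∑ x : (Ico 1 N), -((N : ℂ)⁻¹ * ∑ c ∈ Ico 1 N, Φ c * (Real.cos (2 * Real.pi * (x : ℕ) * c / N) : ℂ)) *
        ((Real.log (2 * Real.sin (Real.pi * (x : ℕ) / N)) : ℝ) : ℂ))
    rw [Finset.sum_coe_sort (Ico 1 N) (fun n => -((N : ℂ)⁻¹ *
        ∑ c ∈ Ico 1 N, Φ c * (Real.cos (2 * Real.pi * n * c / N) : ℂ)) *
        ((Real.log (2 * Real.sin (Real.pi * n / N)) : ℝ) : ℂ))]
    have : ∑ n ∈ Ico 1 N, -((N : ℂ)⁻¹ * ∑ c ∈ Ico 1 N, Φ c * (Real.cos (2 * Real.pi * n * c / N) : ℂ)) *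
        ((Real.log (2 * Real.sin (Real.pi * n / N)) : ℝ) : ℂ) =
        -((N : ℂ)⁻¹ * ∑ n ∈ Ico 1 N, (∑ c ∈ Ico 1 N, Φ c * (Real.cos (2 * Real.pi * n * c / N) : ℂ)) *
        ((Real.log (2 * Real.sin (Real.pi * n / N)) : ℝ) : ℂ)) := by
      rw [Finset.mul_sum, ← Finset.sum_neg_distrib]
      exact Finset.sum_congr rfl fun n _ => by ring
    rw [this]
    ring
  rw [e]
  exact transcendental_pi_mul_add_sum_log A hA hAalg hc₀ hc₀0 hCalg

/-- **Murty–Saradha 2010, Corollary 6.** «If `Σ_{b=1}^{q−1} f(b) cot(πb/q) ≠ 0`, then `L(1,f) ≠ 0`»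
(for algebraic-valued `f` with `Σ f = 0`). [cite: MurtySaradha2010, Corollary 6] -/
theorem LFunction_one_ne_zero_of_sum_cot_ne_zero (Φ : ZMod N → ℂ) (hΦ : ∑ j : ZMod N, Φ j = 0)
    (halg : ∀ j, IsAlgebraic ℚ (Φ j))
    (hcot : ∑ c ∈ Ico 1 N, Φ c * (Real.cot (Real.pi * c / N) : ℂ) ≠ 0) : ZMod.LFunction Φ 1 ≠ 0 :=
  fun h => transcendental_LFunction_one_of_sum_cot_ne_zero Φ hΦ halg hcot (h ▸ isAlgebraic_zero)

/-- **Corollary 6, series form**: under the same hypotheses the convergent series `Σ_{n=1}^{∞} f(n)/n`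
does not tend to `0` (its value is `L(1,f)`, `PeriodicLSeries.tendsto_sum_range_div`).
[cite: MurtySaradha2010, Corollary 6] -/
theorem not_tendsto_sum_div_zero_of_sum_cot_ne_zero (Φ : ZMod N → ℂ) (hΦ : ∑ j : ZMod N, Φ j = 0)
    (halg : ∀ j, IsAlgebraic ℚ (Φ j))
    (hcot : ∑ c ∈ Ico 1 N, Φ c * (Real.cot (Real.pi * c / N) : ℂ) ≠ 0) :
    ¬ Tendsto (fun M : ℕ => ∑ n ∈ range M, Φ ((n + 1 : ℕ) : ZMod N) / ((n + 1 : ℕ) : ℂ)) atTop (𝓝 0) :=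
  fun h => LFunction_one_ne_zero_of_sum_cot_ne_zero Φ hΦ halg hcot
    (tendsto_nhds_unique (tendsto_sum_range_div Φ hΦ) h)

/-! ### Theorem 5 in the printed form: `f(q)/(2q) + (1/q) Σ_b f(b)/(1 − ζ^b)` -/

omit [NeZero N] in
/-- `cot(πb/N) = i − 2i/(1 − e^{2πib/N})` for `1 ≤ b < N` («`cot(πa/q) = i + 2i/(ζ^a − 1)`»).
[cite: MurtySaradha2010, §8 (proof of Corollary 6)] -/
theorem cot_eq_I_sub {b : ℕ} (hb : 1 ≤ b) (hbN : b < N) :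
    (Real.cot (Real.pi * b / N) : ℂ) = I - 2 * I / (1 - cexp (2 * Real.pi * I * b / N)) := by
  have he : cexp (2 * Real.pi * I * b / N) ≠ 1 := exp_ne_one hb hbN
  have h1 : (1 : ℂ) - cexp (2 * Real.pi * I * b / N) ≠ 0 := sub_ne_zero.2 he.symm
  rw [Complex.ofReal_cot, Complex.cot_eq_exp_ratio]
  have e : (2 : ℂ) * I * ((Real.pi * b / N : ℝ) : ℂ) = 2 * Real.pi * I * b / N := by push_cast; ring
  rw [e]
  have hI : I * (1 - cexp (2 * Real.pi * I * b / N)) ≠ 0 := mul_ne_zero I_ne_zero h1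
  field_simp
  linear_combination (cexp (2 * ↑Real.pi * I * ↑b / ↑N) + 1) * I_sq

/-- The `π`-coefficient in the two forms: for `Σ f = 0`,
`Σ_{c=1}^{N−1} f(c) cot(πc/N) = −2iN·( f(0)/(2N) + (1/N) Σ_{b=1}^{N−1} f(b)/(1 − e^{2πib/N}) )`.
[cite: MurtySaradha2010, §7–§8 ((10)–(11))] -/
theorem sum_cot_eq (Φ : ZMod N → ℂ) (hΦ : ∑ j : ZMod N, Φ j = 0) :
    ∑ c ∈ Ico 1 N, Φ c * (Real.cot (Real.pi * c / N) : ℂ) =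
      -2 * I * N * (Φ 0 / (2 * N) + (N : ℂ)⁻¹ * ∑ b ∈ Ico 1 N, Φ b / (1 - cexp (2 * Real.pi * I * b / N))) := by
  have hN : 0 < N := Nat.pos_of_ne_zero (NeZero.ne N)
  have hNC : (N : ℂ) ≠ 0 := by exact_mod_cast hN.ne'
  have hsum0 : ∑ c ∈ Ico 1 N, Φ c = -Φ 0 := by
    have h := sum_range_apply_add_eq_zero Φ hΦ 1
    have e : ∑ n ∈ range N, Φ ((1 + n : ℕ) : ZMod N) =
        ∑ a ∈ range N, (fun c : ℕ => Φ (c : ZMod N)) (a + 1) :=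
      Finset.sum_congr rfl fun n _ => by rw [add_comm]
    rw [e, sum_range_succ_eq (fun c : ℕ => Φ (c : ZMod N)) hN, ZMod.natCast_self] at h
    linear_combination h
  have hc : ∀ c ∈ Ico 1 N, Φ c * (Real.cot (Real.pi * c / N) : ℂ) =
      Φ c * I + (-2 * I) * (Φ c / (1 - cexp (2 * Real.pi * I * c / N))) := by
    intro c hc
    obtain ⟨hc1, hcN⟩ := mem_Ico.1 hc
    rw [cot_eq_I_sub hc1 hcN]
    ring
  rw [Finset.sum_congr rfl hc, Finset.sum_add_distrib, ← Finset.sum_mul, ← Finset.mul_sum, hsum0]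
  field_simp
  ring

/-- **Murty–Saradha 2010, Theorem 5 (as printed, `ζ = e^{2πi/q}`).** «Let `f : ℤ/qℤ → ℚ̄` be an
algebraic-valued function … Suppose further that `Σ_{a=1}^{q} f(a) = 0`. If
`f(q)/(2q) + (1/q) Σ_{b=1}^{q−1} f(b)/(1 − ζ^b) ≠ 0`, then the number `Σ_{n=1}^{∞} f(n)/n` is
transcendental.» Here `f(q) = f(0)` in `ℤ/q`, and the value of the series is `L(1,f)`
(`PeriodicLSeries.tendsto_sum_range_div`). [cite: MurtySaradha2010, Theorem 5] -/
theorem transcendental_LFunction_one_of_ne_zero (Φ : ZMod N → ℂ) (hΦ : ∑ j : ZMod N, Φ j = 0)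
    (halg : ∀ j, IsAlgebraic ℚ (Φ j))
    (h : Φ 0 / (2 * N) + (N : ℂ)⁻¹ * ∑ b ∈ Ico 1 N, Φ b / (1 - cexp (2 * Real.pi * I * b / N)) ≠ 0) :
    Transcendental ℚ (ZMod.LFunction Φ 1) := by
  have hN : 0 < N := Nat.pos_of_ne_zero (NeZero.ne N)
  have hNC : (N : ℂ) ≠ 0 := by exact_mod_cast hN.ne'
  refine transcendental_LFunction_one_of_sum_cot_ne_zero Φ hΦ halg ?_
  rw [sum_cot_eq Φ hΦ]
  exact mul_ne_zero (mul_ne_zero (mul_ne_zero (by norm_num) I_ne_zero) hNC) h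

end MurtySaradha2010

end Literature.NumberTheory.Transcendental
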